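import Summits.RiemannHypothesis.RiemannHypothesis.Theorems.WindowTracePrime2.Negative.ArchBound

/-!
# Bounded local counts bound the shifted sums (regrouping by integer parts)

Negative-side support for crux `SpectralTrace.WindowTracePrime2` (stmt-RiemannHypothesis-11196;
cdisprove seat refuter-cdisprove-stmt-RiemannHypothesis-11196-0).

* `summable_profile` — the profile `W_m = 1/(1+m²) + 1/(1+(m+1)²)` dominating
  `1/(1+u²)` on `[m, m+1)` (`inv_one_add_sq_le_profile`).
* `sum_inv_one_add_sq_le` — if every unit window `[S−1, S+1]` meets at most `M` indices then
  `Σ_{i∈s} 1/(1+(γ_i−T)²) ≤ M · Σ_m W_m` for every finset `s`, uniformly in `T`.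
* `re_weilFunctional_modulate_le_of_ncard_le` — hence for a real family realising the window
  identity (INLINE hypothesis) with bounded local counts, `Re W(k_T) ≤ D² M Σ_m W_m` for all `T`
  (shifted identity + `|φ̂(1/2+iu)|² ≤ D²/(1+u²)`, `norm_sq_weilMellin_le`).
-/

noncomputable section

open Complex Filter Set MeasureTheory
open scoped Real Topology ContDiff

namespace Summit.RiemannHypothesis.RiemannHypothesis.Theorems.WindowTracePrime2.Negative

open Literature.NumberTheory.LFunctions

/-- The summable profile `W_m = 1/(1+m²) + 1/(1+(m+1)²)` dominating `1/(1+u²)` on `[m, m+1)`. -/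
theorem summable_profile :
    Summable fun m : ℤ => 1 / (1 + (m : ℝ) ^ 2) + 1 / (1 + ((m : ℝ) + 1) ^ 2) := by
  have hnat : Summable fun n : ℕ => 1 / (1 + (n : ℝ) ^ 2) := by
    have h2 : Summable fun n : ℕ => 2 * (1 / ((n : ℝ) + 1) ^ 2) := by
      have := (summable_nat_add_iff 1).2 (Real.summable_one_div_nat_pow.2 one_lt_two)
      simpa using this.mul_left 2
    refine Summable.of_nonneg_of_le (fun n => by positivity) (fun n => ?_) h2
    rw [div_le_iff₀ (by positivity), show 2 * (1 / ((n : ℝ) + 1) ^ 2) * (1 + (n : ℝ) ^ 2) =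
      2 * (1 + (n : ℝ) ^ 2) / ((n : ℝ) + 1) ^ 2 by ring, le_div_iff₀ (by positivity)]
    nlinarith [sq_nonneg ((n : ℝ) - 1), Nat.cast_nonneg (α := ℝ) n]
  have hA : Summable fun m : ℤ => 1 / (1 + (m : ℝ) ^ 2) := by
    refine Summable.of_nat_of_neg_add_one (by simpa using hnat) ?_
    refine ((summable_nat_add_iff 1).2 hnat).congr fun n => ?_
    push_cast
    ring
  have hB : Summable fun m : ℤ => 1 / (1 + ((m : ℝ) + 1) ^ 2) := by
    have := (Equiv.addRight (1 : ℤ)).summable_iff.2 hA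
    refine this.congr fun m => ?_
    simp
  exact hA.add hB

/-- `(∑' m : ℤ, (1 / (1 + (m : ℝ) ^ 2) + 1 / (1 + ((m : ℝ) + 1) ^ 2))) ≥ 0`. [folklore] -/
theorem profileSum_nonneg : 0 ≤ (∑' m : ℤ, (1 / (1 + (m : ℝ) ^ 2) + 1 / (1 + ((m : ℝ) + 1) ^ 2))) := tsum_nonneg fun _ => by positivity

/-- `1/(1+u²) ≤ W_{⌊u⌋}`. [folklore] -/
theorem inv_one_add_sq_le_profile {u : ℝ} {m : ℤ} (hm : ⌊u⌋ = m) :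
    1 / (1 + u ^ 2) ≤ 1 / (1 + (m : ℝ) ^ 2) + 1 / (1 + ((m : ℝ) + 1) ^ 2) := by
  have h1 : (m : ℝ) ≤ u := by rw [← hm]; exact Int.floor_le u
  have h2 : u < (m : ℝ) + 1 := by rw [← hm]; exact Int.lt_floor_add_one u
  rcases le_or_gt 0 (m : ℝ) with hm0 | hm0
  · have : 1 / (1 + u ^ 2) ≤ 1 / (1 + (m : ℝ) ^ 2) := by
      apply one_div_le_one_div_of_le (by positivity)
      nlinarith
    linarith [show (0 : ℝ) ≤ 1 / (1 + ((m : ℝ) + 1) ^ 2) by positivity]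
  · have : 1 / (1 + u ^ 2) ≤ 1 / (1 + ((m : ℝ) + 1) ^ 2) := by
      apply one_div_le_one_div_of_le (by positivity)
      have hm1 : (m : ℝ) + 1 ≤ 0 := by
        have : m ≤ -1 := by
          have : (m : ℝ) < 0 := hm0
          exact Int.le_sub_one_iff.2 (by exact_mod_cast this)
        have : (m : ℝ) ≤ -1 := by exact_mod_cast this
        linarith
      nlinarith
    linarith [show (0 : ℝ) ≤ 1 / (1 + (m : ℝ) ^ 2) by positivity]

/-- **Regrouping under bounded local counts.** If every unit window `[S-1, S+1]` meets at most `M`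
indices (a uniformly discrete family, a finite union of lattices, a Paley–Wiener zero set, …)
then every finite partial sum of `1/(1+(γ_i−T)²)` is `≤ M · (∑' m : ℤ, (1 / (1 + (m : ℝ) ^ 2) + 1 / (1 + ((m : ℝ) + 1) ^ 2)))`, uniformly in `T`. -/
theorem sum_inv_one_add_sq_le {ι : Type} (γ : ι → ℝ) {M : ℝ}
    (hfin : ∀ S : ℝ, {i : ι | |γ i - S| ≤ 1}.Finite)
    (hM : ∀ S : ℝ, ({i : ι | |γ i - S| ≤ 1}.ncard : ℝ) ≤ M) (T : ℝ) (s : Finset ι) :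
    ∑ i ∈ s, 1 / (1 + (γ i - T) ^ 2) ≤ M * (∑' m : ℤ, (1 / (1 + (m : ℝ) ^ 2) + 1 / (1 + ((m : ℝ) + 1) ^ 2))) := by
  classical
  have hM0 : 0 ≤ M := le_trans (by positivity) (hM 0)
  set g : ι → ℤ := fun i => ⌊γ i - T⌋ with hg
  set W : ℤ → ℝ := fun m => 1 / (1 + (m : ℝ) ^ 2) + 1 / (1 + ((m : ℝ) + 1) ^ 2) with hW
  -- regroup by the integer part of `γ_i - T`
  rw [← Finset.sum_fiberwise_of_maps_to (g := g) (t := s.image g) (fun i hi => Finset.mem_image_of_mem g hi)]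
  -- each fibre: at most `M` terms, each `≤ W m`
  have hfib : ∀ m ∈ s.image g, ∑ i ∈ s with g i = m, 1 / (1 + (γ i - T) ^ 2) ≤ M * W m := by
    intro m _
    have hcard : (((s.filter fun i => g i = m).card : ℕ) : ℝ) ≤ M := by
      have hsub : (↑(s.filter fun i => g i = m) : Set ι) ⊆ {i : ι | |γ i - (T + m + 1 / 2)| ≤ 1} := by
        intro i hi
        rw [Finset.coe_filter] at hi
        obtain ⟨_, him⟩ := hi
        have h1 : (m : ℝ) ≤ γ i - T := by rw [← him]; exact Int.floor_le _
        have h2 : γ i - T < (m : ℝ) + 1 := by rw [← him]; exact Int.lt_floor_add_one _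
        simp only [Set.mem_setOf_eq]
        rw [abs_le]
        constructor <;> linarith
      have h := Set.ncard_le_ncard hsub (hfin _)
      rw [Set.ncard_coe_finset] at h
      exact le_trans (by exact_mod_cast h) (hM _)
    have hterm : ∀ i ∈ s.filter (fun i => g i = m), 1 / (1 + (γ i - T) ^ 2) ≤ W m := by
      intro i hi
      exact inv_one_add_sq_le_profile (Finset.mem_filter.1 hi).2
    calc ∑ i ∈ s with g i = m, 1 / (1 + (γ i - T) ^ 2)
        ≤ ∑ i ∈ s with g i = m, W m := Finset.sum_le_sum hterm
      _ = ((s.filter fun i => g i = m).card : ℝ) * W m := by rw [Finset.sum_const, nsmul_eq_mul]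
      _ ≤ M * W m := mul_le_mul_of_nonneg_right hcard (by positivity)
  calc ∑ m ∈ s.image g, ∑ i ∈ s with g i = m, 1 / (1 + (γ i - T) ^ 2)
      ≤ ∑ m ∈ s.image g, M * W m := Finset.sum_le_sum hfib
    _ = M * ∑ m ∈ s.image g, W m := by rw [Finset.mul_sum]
    _ ≤ M * (∑' m : ℤ, (1 / (1 + (m : ℝ) ^ 2) + 1 / (1 + ((m : ℝ) + 1) ^ 2))) := by
        refine mul_le_mul_of_nonneg_left ?_ hM0
        exact (summable_profile.sum_le_tsum (s.image g) fun m _ => by positivity)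

/-- `|φ̂(1/2+iu)|² ≤ D²/(1+u²)` with `D = weilDecayW 0 φ`. -/
theorem norm_sq_weilMellin_le {φ : ℝ → ℂ} (hφ : IsWeilTest φ) (u : ℝ) :
    ‖weilMellin φ (1 / 2 + (u : ℂ) * I)‖ ^ 2 ≤ weilDecayW 0 φ ^ 2 * (1 / (1 + u ^ 2)) := by
  have h := norm_weilMellin_vertical_le hφ (1 / 2) u
  rw [show |(1 / 2 : ℝ) - 1 / 2| = 0 by norm_num] at h
  have e : (((1 / 2 : ℝ) : ℂ) + u * I) = 1 / 2 + (u : ℂ) * I := by push_cast; ring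
  rw [e] at h
  have hD : 0 ≤ weilDecayW 0 φ := weilDecayW_nonneg 0 φ
  have h0 : 0 ≤ ‖weilMellin φ (1 / 2 + (u : ℂ) * I)‖ := norm_nonneg _
  have hinv : (1 + u ^ 2)⁻¹ ≤ 1 := inv_le_one_of_one_le₀ (by nlinarith)
  have hinv0 : 0 ≤ (1 + u ^ 2)⁻¹ := by positivity
  calc ‖weilMellin φ (1 / 2 + (u : ℂ) * I)‖ ^ 2 ≤ (weilDecayW 0 φ * (1 + u ^ 2)⁻¹) ^ 2 :=
        pow_le_pow_left₀ h0 h 2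
    _ = weilDecayW 0 φ ^ 2 * (1 + u ^ 2)⁻¹ * (1 + u ^ 2)⁻¹ := by ring
    _ ≤ weilDecayW 0 φ ^ 2 * (1 + u ^ 2)⁻¹ * 1 := by gcongr
    _ = weilDecayW 0 φ ^ 2 * (1 / (1 + u ^ 2)) := by ring

/-- **Under bounded local counts `Re W(k_T)` is bounded uniformly in `T`.** -/
theorem re_weilFunctional_modulate_le_of_ncard_le {A : ℝ} {ι : Type} {γ : ι → ℝ}
    (h : (∀ g : ℝ → ℂ, IsWeilTest g → tsupport g ⊆ Set.Icc (-A) A →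
        HasSum (fun i => weilMellin g (1 / 2 + (γ i : ℂ) * Complex.I)) (weilFunctional g)))
    {φ : ℝ → ℂ} (hφ : IsWeilTest φ) {a : ℝ} (hφs : tsupport φ ⊆ Set.Icc (-a) a) (h2a : 2 * a ≤ A)
    {M : ℝ} (hfin : ∀ S : ℝ, {i : ι | |γ i - S| ≤ 1}.Finite)
    (hM : ∀ S : ℝ, ({i : ι | |γ i - S| ≤ 1}.ncard : ℝ) ≤ M) (T : ℝ) :
    (weilFunctional ((fun t => weilConv φ (weilReflect φ) t * cexp (((-(T * t) : ℝ) : ℂ) * I)))).re ≤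
      weilDecayW 0 φ ^ 2 * (M * (∑' m : ℤ, (1 / (1 + (m : ℝ) ^ 2) + 1 / (1 + ((m : ℝ) + 1) ^ 2)))) := by
  have hS := hasSum_norm_sq_shift h hφ hφs h2a T
  refine hasSum_le_of_sum_le hS fun s => ?_
  calc ∑ i ∈ s, ‖weilMellin φ (1 / 2 + ((γ i - T : ℝ) : ℂ) * I)‖ ^ 2
      ≤ ∑ i ∈ s, weilDecayW 0 φ ^ 2 * (1 / (1 + (γ i - T) ^ 2)) :=
        Finset.sum_le_sum fun i _ => norm_sq_weilMellin_le hφ (γ i - T)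
    _ = weilDecayW 0 φ ^ 2 * ∑ i ∈ s, 1 / (1 + (γ i - T) ^ 2) := by rw [Finset.mul_sum]
    _ ≤ weilDecayW 0 φ ^ 2 * (M * (∑' m : ℤ, (1 / (1 + (m : ℝ) ^ 2) + 1 / (1 + ((m : ℝ) + 1) ^ 2)))) :=
        mul_le_mul_of_nonneg_left (sum_inv_one_add_sq_le γ hfin hM T s) (sq_nonneg _)

end Summit.RiemannHypothesis.RiemannHypothesis.Theorems.WindowTracePrime2.Negative

end
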